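import Summits.CriticalPhenomena.PercolationContinuityZ3.Theorems.Transplant.SiteZ2Annulus
import Summits.CriticalPhenomena.PercolationContinuityZ3.Theorems.Transplant.SiteZ2Criterion
import Summits.CriticalPhenomena.PercolationContinuityZ3.Theorems.PercMonotoneFactorsClassNoJumpPlanar
import HarnessLib

/-!
# `SitePercolationContinuity 2`: Bernoulli SITE percolation on `ℤ²` does not percolate at its own
# critical density

builds on p205010 (kernel theorem, internal audit signed; external expert review pending).

Helper file (`--supports stmt-CriticalPhenomena-4575`). **`θ^{site}_{ℤ²}(p_c^{site}(ℤ²)) = 0`**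
(`sitePercolationContinuity_two`), in print Kesten 1982, §3.4 Application (iv) / Russo 1981; the
one dimension of the site family `SitePercolationContinuity d` not covered by the tree's site
Kozma–Nitzan chain (`SiteKN.sitePercolationContinuity_holds`, `3 ≤ d`).

Proof (`siteTheta_eq_zero_of_forall_lt`, the Harris–RSW dichotomy of the tree's
`ClassNoJumpPlanar_proof`, run for the bond encoding `SiteZ2.law (zdGraph 2) t` of site percolation —
a lattice-carried, `Aut(ℤ²)`-invariant, positively associated, range-`0` finitely dependent bond
measure with polynomial continuity in the density, `SiteZ2Encoding.lean`): suppose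
`θ^{site}(s) = 0` for all `s < t`. `t = 0`: nothing is open. `t = 1`: every rectangle is crossed, so
by continuity and the finite-size criterion (`exists_site_criterion`) `θ^{site}(s) > 0` at some
`s < 1` — contradiction. `0 < t < 1`: either the short-way dual crossings `𝓒₁(N, 8N)` of the dual
measure stay `≥ ε > 0` at all large scales — then the weak Köhler-Schindler–Tassion RSW theorem for
the dual and the square-annulus argument give `θ^{site}(t) = 0` (`siteTheta_eq_zero_of_dual_crossings`);
or they drop below the universal `ε₀` at some scale `N ≥ 2` — then planar duality makes the long-way
crossing of `[0, 6N] × [0, 2N]` more likely than `1 - ε₀` at `t`, hence (continuity) at some `s < t`,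
where the criterion gives `θ^{site}(s) > 0`: contradiction. At `t = p_c^{site}(ℤ²)` the hypothesis
holds by the definition of the critical density (`siteTheta_eq_zero_of_lt`).

## References

* H. Kesten, *Percolation theory for mathematicians*, Birkhäuser (1982), §3.4, Application (iv).
* L. Russo, *On the critical percolation probabilities*, Z. Wahrsch. verw. Geb. 56 (1981) 229–237.
* L. Köhler-Schindler, V. Tassion, Duke Math. J. 172 (2023), Theorem 1 and Comment 1.
* T. E. Harris, Proc. Cambridge Philos. Soc. 56 (1960) 13–20.
-/

noncomputable section

namespace Summit.CriticalPhenomena.PercolationContinuityZ3.Theorems.Transplant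

namespace SiteZ2

open MeasureTheory ProbabilityTheory Literature.Probability.Percolation
  Literature.Probability.LatticeModels KSTPeriodic
open Summit.CriticalPhenomena.PercolationContinuityZ3.Theorems.PercMonotoneFactorsClassNoJumpPlanar

/-- **No jump from zero for site percolation on `ℤ²`**: if `θ^{site}_{ℤ²}(s) = 0` for every `s < t`
then `θ^{site}_{ℤ²}(t) = 0` (Harris–RSW dichotomy for the bond encoding of site percolation).
[cite: KestenPTM1982, §3.4 Application (iv)] -/
theorem siteTheta_eq_zero_of_forall_lt (t : unitInterval)
    (ht : ∀ s : unitInterval, s < t → siteTheta (zdGraph 2) (0 : Site 2) s = 0) :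
    siteTheta (zdGraph 2) (0 : Site 2) t = 0 := by
  obtain ⟨ε₀, hε₀, hcrit⟩ := exists_site_criterion
  -- KEY: a very likely long crossing at `t > 0` percolates slightly below `t`
  have key : 0 < (t : ℝ) → ∀ L : ℕ, 3 ≤ L →
      1 - ε₀ < (law (zdGraph 2) t).real (KSTPeriodic.lrRect 0 (3 * (L : ℤ)) 0 L) → False := by
    intro ht0 L hL hbig
    obtain ⟨s, hst, hs⟩ := exists_lt_of_continuousAt
      ((continuous_real_lrRect_law 0 (3 * (L : ℤ)) 0 L).continuousAt) ht0 hbig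
    exact (hcrit s L hL hs.le).ne' (ht s hst)
  rcases eq_or_lt_of_le t.2.1 with ht0 | ht0
  · -- `t = 0`
    have : t = 0 := Subtype.ext ht0.symm
    subst this
    exact siteTheta_bot (zdGraph 2) 0
  rcases eq_or_lt_of_le t.2.2 with ht1 | ht1
  · -- `t = 1`: the hypothesis fails just below `1`
    exfalso
    have : t = 1 := Subtype.ext ht1
    subst this
    refine key ht0 3 le_rfl ?_
    have h1 := real_lrRect_law_one 9 3
    have h9 : (3 * ((3 : ℕ) : ℤ)) = ((9 : ℕ) : ℤ) := by norm_num
    rw [h9, h1]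
    linarith
  · by_cases hA : ∃ ε : ℝ, 0 < ε ∧ ∃ N₀ : ℕ, ∀ N : ℕ, N₀ ≤ N →
        ε ≤ ((law (zdGraph 2) t).map dualConfig).real (KSTPeriodic.crossing 1 N (8 * N))
    · obtain ⟨ε, hε, N₀, hN⟩ := hA
      exact siteTheta_eq_zero_of_dual_crossings ht1 hε hN
    · exfalso
      push Not at hA
      obtain ⟨N, hN, hlt⟩ := hA ε₀ hε₀ 2
      refine key ht0 (2 * N) (by omega) ?_
      have hD := one_sub_dual_crossing_le_real_lrRect (admissible_law t) (latticeCarried_law t)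
        (N := N) (by omega)
      have hcast : (3 * ((2 * N : ℕ) : ℤ)) = 6 * (N : ℤ) := by push_cast; ring
      rw [hcast]
      push_cast
      linarith

/-- **`SitePercolationContinuity 2`: `θ^{site}_{ℤ²}(p_c^{site}(ℤ²)) = 0`** — Bernoulli site
percolation on the square lattice has, at its own critical density, almost surely no infinite open
site cluster at the origin (Kesten 1982, §3.4 Application (iv); Russo 1981).
[cite: KestenPTM1982, §3.4 Application (iv)] -/
theorem sitePercolationContinuity_two : SitePercolationContinuity 2 :=
  siteTheta_eq_zero_of_forall_lt _ fun _ hs => siteTheta_eq_zero_of_lt (Subtype.coe_lt_coe.2 hs)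

end SiteZ2

end Summit.CriticalPhenomena.PercolationContinuityZ3.Theorems.Transplant

end
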